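import Summits.AtomisticToContinuum.Crystallization.Theorems.PalmUnimodularRigidityMinimiserShellsEnergyFloor
import HarnessLib

/-!
# The random-grid CELL-AVERAGING identity for point-stationary hard-core laws

Support file for the crux `ThreeConeCertificate.SlackRigidity` (stmt-AtomisticToContinuum-11960), line
`ekeland-surgery-parity`, lead c14's law-rigidity programme (`SlackRigidity ⇒` rigidity of minimising
point-stationary hard-core laws).  It GENERALISES the random-grid mass transport of item 9229
(`…PalmUnimodularRigidityMinimiserShellsEnergyFloor*`, where the transported quantity is the local
energy) to an arbitrary jointly measurable, phase-periodic functional `f μ v` of the rooted configuration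
`μ` and the phase `v ∈ [0,1)³` of the cubic grid of mesh `L`:

**`lintegral_phase_eq_cellAverage`.**  For a point-stationary law `P` that is a.s. rooted `δ`-hard-core,
`E_P[ ∫_{[0,1)³} f(μ, v) dv ] = E_P[ ∫_{[0,1)³} (1/#T_v) ∑_{y ∈ T_v} f(θ_y μ, v - L⁻¹ y) dv ]`,
where `T_v = atoms(μ) ∩ rootCell L v` is the root's cluster and `θ_y μ = μ.map (· - y)`; the phase
shift `-L⁻¹ y` is exactly the one making the root's cell of `θ_y μ` the old cell seen from `y`
(`preimage_sub_rootCell`).  "The mean of `f` at the root is the mean of the cell-average of `f` over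
the root's cell-mates."  Proof: Mecke with the transport
`g(μ, y) = ∫ 1[y ∈ rootCell L v] · f(μ, v) / μ(rootCell L v) dv` (the root sends `f(μ,v)/#T_v` to each
cell-mate), OUT `= ∫ f(μ, v) dv` (`lintegral_transportOf_eq`), IN `=` the cell average
(`lintegral_transportOf_map_eq`).  No definitions are introduced (the transport is written out).  All `[folklore]` (Mecke 1967 / Last–Thorisson 2009 mass transport).
-/

noncomputable section

open MeasureTheory
open scoped ENNReal BigOperators

namespace Summit.AtomisticToContinuum.Crystallization.Theorems.SlackRigidityLawCellAverage

open Literature.Probability.Process (IsPointStationaryLaw IsRootedHardCore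
  count_restrict_singleton_ne_zero_iff map_sub_count_restrict)
open Summit.AtomisticToContinuum.Crystallization.Theorems.PalmUnimodularRigidityMinimiserShells.EnergyFloor
open Summit.AtomisticToContinuum.Crystallization.Theorems.MinimiserShells.Negative.Rootedness
  (countable_of_separated)

variable {δ L : ℝ}

/-! ## The transport of a phase functional -/

/-! The transport of `f` is the map
`g(μ, y) = ∫_{[0,1)³} 1[y ∈ rootCell L v] · f(μ, v) / (trunc δ μ)(rootCell L v) dv` — the root sends
the share `f(μ, v)/#cell` to each point `y` of its cell, averaged over the phase; it is written out
in full below (no definition is introduced). -/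

variable {f : Measure (EuclideanSpace ℝ (Fin 3)) → EuclideanSpace ℝ (Fin 3) → ℝ≥0∞}

/-- The share `(μ, v) ↦ f(μ, v) / (trunc δ μ)(rootCell L v)` is jointly measurable. [folklore] -/
theorem measurable_shareOf (δ L : ℝ) (hf : Measurable (Function.uncurry f)) :
    Measurable fun p : Measure (EuclideanSpace ℝ (Fin 3)) × EuclideanSpace ℝ (Fin 3) =>
      f p.1 p.2 / trunc δ p.1 (rootCell L p.2) :=
  hf.div (measurable_trunc_rootCell δ L)

/-- The transport integrand in the variables `((μ, v), y)` is jointly measurable. [folklore] -/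
theorem measurable_transportOf_integrand' (δ L : ℝ) (hf : Measurable (Function.uncurry f)) :
    Measurable fun q : (Measure (EuclideanSpace ℝ (Fin 3)) × EuclideanSpace ℝ (Fin 3)) ×
        EuclideanSpace ℝ (Fin 3) =>
      (rootCell L q.1.2).indicator (fun _ => f q.1.1 q.1.2 / trunc δ q.1.1 (rootCell L q.1.2)) q.2 :=
  measurable_indicator_param (s := fun a : Measure (EuclideanSpace ℝ (Fin 3)) ×
      EuclideanSpace ℝ (Fin 3) => rootCell L a.2)
    ((measurableSet_cellIdx_eq L 0).preimage (measurable_fst.snd.prodMk measurable_snd))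
    ((measurable_shareOf δ L hf).comp measurable_fst)

/-- The transport integrand `((μ, y), v) ↦ 1[y ∈ rootCell L v] · share` is jointly measurable.
[folklore] -/
theorem measurable_transportOf_integrand (δ L : ℝ) (hf : Measurable (Function.uncurry f)) :
    Measurable fun q : (Measure (EuclideanSpace ℝ (Fin 3)) × EuclideanSpace ℝ (Fin 3)) ×
        EuclideanSpace ℝ (Fin 3) =>
      (rootCell L q.2).indicator (fun _ => f q.1.1 q.2 / trunc δ q.1.1 (rootCell L q.2)) q.1.2 :=
  (measurable_transportOf_integrand' δ L hf).comp
    ((measurable_fst.fst.prodMk measurable_snd).prodMk measurable_fst.snd)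

/-- **The transport of a jointly measurable `f` is jointly measurable** (so Mecke applies).
[folklore] -/
theorem measurable_transportOf (δ L : ℝ) (hf : Measurable (Function.uncurry f)) :
    Measurable (Function.uncurry
      (fun μ y => ∫⁻ v in phaseDom, (rootCell L v).indicator (fun _ => f μ v / trunc δ μ (rootCell L v)) y)) :=
  (measurable_transportOf_integrand δ L hf).lintegral_prod_right'

/-- For fixed configuration and point the transport integrand is measurable in the phase.
[folklore] -/
theorem measurable_transportOf_integrand_phase (δ L : ℝ) (hf : Measurable (Function.uncurry f))
    (μ : Measure (EuclideanSpace ℝ (Fin 3))) (y : EuclideanSpace ℝ (Fin 3)) :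
    Measurable fun v : EuclideanSpace ℝ (Fin 3) =>
      (rootCell L v).indicator (fun _ => f μ v / trunc δ μ (rootCell L v)) y :=
  (measurable_transportOf_integrand δ L hf).comp (measurable_prodMk_left (x := (μ, y)))

/-- For a fixed configuration, `f μ ·` is measurable in the phase. [folklore] -/
theorem measurable_phase (hf : Measurable (Function.uncurry f))
    (μ : Measure (EuclideanSpace ℝ (Fin 3))) : Measurable fun v => f μ v :=
  hf.comp (measurable_prodMk_left (x := μ))

/-! ## OUT: the mass sent by the root -/

/-- **OUT**: the total mass sent out of the root of a rooted hard-core configuration is the phase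
integral of `f` (each of the `#cell` cell-mates receives `f/#cell`). [folklore] -/
theorem lintegral_transportOf_eq (hδ : 0 < δ) (hL : 0 < L) (hf : Measurable (Function.uncurry f))
    {μ : Measure (EuclideanSpace ℝ (Fin 3))} (hμ : IsRootedHardCore δ μ) :
    ∫⁻ y, (∫⁻ v in phaseDom, (rootCell L v).indicator (fun _ => f μ v / trunc δ μ (rootCell L v)) y) ∂μ =
      ∫⁻ v in phaseDom, f μ v := by
  have hμ' := hμ
  have hmem := mem_hcClass_of_hc hδ hμ
  obtain ⟨S, h0, hsep, rfl⟩ := hμ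
  have hS := countable_of_separated hδ hsep
  refine (lintegral_count_restrict_setLIntegral_comm hS
    (fun y => measurable_transportOf_integrand_phase δ L hf _ y) phaseDom).trans ?_
  refine lintegral_congr fun v => ?_
  rw [lintegral_indicator_const (measurableSet_rootCell L v)]
  obtain ⟨hn0, hntop⟩ := trunc_rootCell_ne_zero_ne_top hδ hL hμ' v
  rw [trunc_of_mem hmem] at hn0 hntop ⊢
  exact ENNReal.div_mul_cancel hn0 hntop

/-! ## IN: the mass received by the root -/

variable {S : Set (EuclideanSpace ℝ (Fin 3))}

/-- **Count of the shifted cell.** Seen from its point `y ∈ rootCell L v ∩ S`, at the shifted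
phase `v - L⁻¹ • y`, the root's cell of the re-rooted configuration has the same (truncated) mass
as the old cell. [folklore] -/
theorem trunc_map_sub_rootCell_eq (hδ : 0 < δ) (hL : 0 < L) (h0 : (0 : EuclideanSpace ℝ (Fin 3)) ∈ S)
    (hsep : ∀ x ∈ S, ∀ y ∈ S, x ≠ y → δ ≤ dist x y) {v y : EuclideanSpace ℝ (Fin 3)}
    (hy : y ∈ rootCell L v ∩ S) :
    trunc δ (((Measure.count : Measure (EuclideanSpace ℝ (Fin 3))).restrict S).map fun z => z - y)
        (rootCell L (v - L⁻¹ • y)) =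
      ((Measure.count : Measure (EuclideanSpace ℝ (Fin 3))).restrict S) (rootCell L v) := by
  have hμ : IsRootedHardCore δ ((Measure.count : Measure (EuclideanSpace ℝ (Fin 3))).restrict S) :=
    ⟨S, h0, hsep, rfl⟩
  have hν : IsRootedHardCore δ
      (((Measure.count : Measure (EuclideanSpace ℝ (Fin 3))).restrict S).map fun z => z - y) :=
    hμ.map_sub ((count_restrict_singleton_ne_zero_iff S y).2 hy.2)
  rw [trunc_of_mem (mem_hcClass_of_hc hδ hν),
    Measure.map_apply (measurable_sub_const y) (measurableSet_rootCell L _),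
    preimage_sub_rootCell hL.ne' hy.1]

/-- **Mass received at the root at a fixed phase** `=` the cell average
`(∑_{y ∈ T} f(θ_y μ, v - L⁻¹ y)) / #T` over the cluster `T = rootCell L v ∩ S`. [folklore] -/
theorem lintegral_received_eq (hδ : 0 < δ) (hL : 0 < L) (h0 : (0 : EuclideanSpace ℝ (Fin 3)) ∈ S)
    (hsep : ∀ x ∈ S, ∀ y ∈ S, x ≠ y → δ ≤ dist x y) {T : Finset (EuclideanSpace ℝ (Fin 3))}
    {v : EuclideanSpace ℝ (Fin 3)} (hT : (↑T : Set (EuclideanSpace ℝ (Fin 3))) = rootCell L v ∩ S) :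
    ∫⁻ y, (rootCell L (v - L⁻¹ • y)).indicator
        (fun _ => f (((Measure.count : Measure (EuclideanSpace ℝ (Fin 3))).restrict S).map fun z => z - y)
          (v - L⁻¹ • y) /
          trunc δ (((Measure.count : Measure (EuclideanSpace ℝ (Fin 3))).restrict S).map fun z => z - y)
            (rootCell L (v - L⁻¹ • y))) (-y)
        ∂((Measure.count : Measure (EuclideanSpace ℝ (Fin 3))).restrict S) =
      (∑ y ∈ T, f (((Measure.count : Measure (EuclideanSpace ℝ (Fin 3))).restrict S).map
          fun z => z - y) (v - L⁻¹ • y)) / T.card := by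
  set μ : Measure (EuclideanSpace ℝ (Fin 3)) :=
    (Measure.count : Measure (EuclideanSpace ℝ (Fin 3))).restrict S with hμdef
  have hL0 : L ≠ 0 := hL.ne'
  -- the integrand is supported on the root's cell
  have hpt : ∀ y : EuclideanSpace ℝ (Fin 3), (rootCell L (v - L⁻¹ • y)).indicator
      (fun _ => f (μ.map fun z => z - y) (v - L⁻¹ • y) /
        trunc δ (μ.map fun z => z - y) (rootCell L (v - L⁻¹ • y))) (-y) =
      (rootCell L v).indicator (fun y => f (μ.map fun z => z - y) (v - L⁻¹ • y) /
        trunc δ (μ.map fun z => z - y) (rootCell L (v - L⁻¹ • y))) y := by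
    intro y
    by_cases hy : y ∈ rootCell L v
    · rw [Set.indicator_of_mem ((neg_mem_rootCell_iff hL0 v y).2 hy), Set.indicator_of_mem hy]
    · rw [Set.indicator_of_notMem (fun h => hy ((neg_mem_rootCell_iff hL0 v y).1 h)),
        Set.indicator_of_notMem hy]
  simp_rw [hpt]
  rw [lintegral_indicator (measurableSet_rootCell L v), hμdef, setLIntegral_rootCell_eq_sum hT]
  -- on the cluster, the shifted count is `#T`
  have hcard : ∀ y ∈ T, trunc δ ((((Measure.count : Measure (EuclideanSpace ℝ (Fin 3))).restrict S).map
      fun z => z - y)) (rootCell L (v - L⁻¹ • y)) = T.card := by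
    intro y hy
    have hy' : y ∈ rootCell L v ∩ S := by rw [← hT]; exact hy
    rw [trunc_map_sub_rootCell_eq hδ hL h0 hsep hy', count_restrict_rootCell_eq_card hT]
  rw [Finset.sum_congr rfl fun y hy => by rw [hcard y hy]]
  simp_rw [ENNReal.div_eq_inv_mul]
  rw [← Finset.mul_sum]

/-- **IN**: the total mass received at the root of a rooted hard-core configuration is the phase
integral of the CELL AVERAGE `(∫_{rootCell} f(θ_y μ, v - L⁻¹ y) dμ(y)) / μ(rootCell)`. [folklore] -/
theorem lintegral_transportOf_map_eq (hδ : 0 < δ) (hL : 0 < L) (hf : Measurable (Function.uncurry f))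
    (hper : ∀ (μ : Measure (EuclideanSpace ℝ (Fin 3))) (k v : EuclideanSpace ℝ (Fin 3)),
      (∀ i, ∃ m : ℤ, k i = m) → f μ (k + v) = f μ v)
    {μ : Measure (EuclideanSpace ℝ (Fin 3))} (hμ : IsRootedHardCore δ μ) :
    ∫⁻ y, (∫⁻ v in phaseDom, (rootCell L v).indicator
        (fun _ => f (μ.map fun z => z - y) v / trunc δ (μ.map fun z => z - y) (rootCell L v)) (-y)) ∂μ =
      ∫⁻ v in phaseDom, (∫⁻ y in rootCell L v, f (μ.map fun z => z - y) (v - L⁻¹ • y) ∂μ) /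
        μ (rootCell L v) := by
  obtain ⟨S, h0, hsep, rfl⟩ := hμ
  have hS := countable_of_separated hδ hsep
  have hL0 : L ≠ 0 := hL.ne'
  -- Step 1: phase shift inside the transport (periodicity of the cell and of `f`)
  have hshift : ∀ y : EuclideanSpace ℝ (Fin 3), ∀ ν : Measure (EuclideanSpace ℝ (Fin 3)),
      (∫⁻ v in phaseDom, (rootCell L v).indicator (fun _ => f ν v / trunc δ ν (rootCell L v)) (-y)) =
        ∫⁻ v in phaseDom, (rootCell L (v - L⁻¹ • y)).indicator
          (fun _ => f ν (v - L⁻¹ • y) / trunc δ ν (rootCell L (v - L⁻¹ • y))) (-y) := by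
    intro y ν
    exact (setLIntegral_phaseDom_sub (measurable_transportOf_integrand_phase δ L hf ν (-y))
      (fun k hk w => by simp only [rootCell_int_add hk, hper ν k w hk]) (L⁻¹ • y)).symm
  simp_rw [hshift]
  -- Step 2: swap the configuration sum and the phase integral
  rw [lintegral_count_restrict_setLIntegral_comm hS
    (F := fun y v => (rootCell L (v - L⁻¹ • y)).indicator (fun _ => f
      (((Measure.count : Measure (EuclideanSpace ℝ (Fin 3))).restrict S).map fun z => z - y)
      (v - L⁻¹ • y) / trunc δ
      (((Measure.count : Measure (EuclideanSpace ℝ (Fin 3))).restrict S).map fun z => z - y)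
      (rootCell L (v - L⁻¹ • y))) (-y))
    (fun y => (measurable_transportOf_integrand_phase δ L hf _ (-y)).comp (measurable_sub_const _))
    phaseDom]
  -- Step 3: pointwise in the phase, through the cluster
  refine lintegral_congr fun v => ?_
  obtain ⟨T, hT, -⟩ := exists_cluster hδ hL h0 hsep v
  rw [lintegral_received_eq hδ hL h0 hsep hT, setLIntegral_rootCell_eq_sum hT,
    count_restrict_rootCell_eq_card hT]

/-! ## The identity -/

/-- **The cell-averaging identity.** For a point-stationary law `P` that is almost surely a rooted
`δ`-hard-core configuration and a jointly measurable, `ℤ³`-phase-periodic `f`,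
`E_P[ ∫_{[0,1)³} f(μ, v) dv ] = E_P[ ∫_{[0,1)³} (∫_{rootCell L v} f(θ_y μ, v - L⁻¹ y) dμ(y)) / μ(rootCell L v) dv ]`
(Mecke identity for the transport of `f`, OUT `lintegral_transportOf_eq`, IN
`lintegral_transportOf_map_eq`). [folklore] -/
theorem lintegral_phase_eq_cellAverage (hδ : 0 < δ) (hL : 0 < L) (hf : Measurable (Function.uncurry f))
    (hper : ∀ (μ : Measure (EuclideanSpace ℝ (Fin 3))) (k v : EuclideanSpace ℝ (Fin 3)),
      (∀ i, ∃ m : ℤ, k i = m) → f μ (k + v) = f μ v)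
    {P : Measure (Measure (EuclideanSpace ℝ (Fin 3)))} (hcore : ∀ᵐ μ ∂P, IsRootedHardCore δ μ)
    (hstat : IsPointStationaryLaw P) :
    ∫⁻ μ, (∫⁻ v in phaseDom, f μ v) ∂P =
      ∫⁻ μ, (∫⁻ v in phaseDom, (∫⁻ y in rootCell L v, f (μ.map fun z => z - y) (v - L⁻¹ • y) ∂μ) /
        μ (rootCell L v)) ∂P := by
  have hM := hstat _ (measurable_transportOf δ L hf)
  calc ∫⁻ μ, (∫⁻ v in phaseDom, f μ v) ∂P
      = ∫⁻ μ, (∫⁻ y, (∫⁻ v in phaseDom, (rootCell L v).indicator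
          (fun _ => f μ v / trunc δ μ (rootCell L v)) y) ∂μ) ∂P :=
        lintegral_congr_ae (hcore.mono fun μ hμ => (lintegral_transportOf_eq hδ hL hf hμ).symm)
    _ = ∫⁻ μ, (∫⁻ y, (∫⁻ v in phaseDom, (rootCell L v).indicator
          (fun _ => f (μ.map fun z => z - y) v / trunc δ (μ.map fun z => z - y) (rootCell L v)) (-y))
          ∂μ) ∂P := hM
    _ = _ := lintegral_congr_ae (hcore.mono fun μ hμ => lintegral_transportOf_map_eq hδ hL hf hper hμ)

/-- **Registered form** (stub `cellAverage_identity` of crux stmt-AtomisticToContinuum-11960): the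
cell-averaging identity with all hypotheses explicit. [folklore] -/
theorem cellAverage_identity : ∀ (δ L : ℝ), 0 < δ → 0 < L → ∀ (f : Measure (EuclideanSpace ℝ (Fin 3)) → EuclideanSpace ℝ (Fin 3) → ℝ≥0∞), Measurable (Function.uncurry f) → (∀ (μ : Measure (EuclideanSpace ℝ (Fin 3))) (k v : EuclideanSpace ℝ (Fin 3)), (∀ i, ∃ m : ℤ, k i = m) → f μ (k + v) = f μ v) → ∀ (P : Measure (Measure (EuclideanSpace ℝ (Fin 3)))), (∀ᵐ μ ∂P, IsRootedHardCore δ μ) → IsPointStationaryLaw P → ∫⁻ μ, (∫⁻ v in phaseDom, f μ v) ∂P = ∫⁻ μ, (∫⁻ v in phaseDom, (∫⁻ y in rootCell L v, f (μ.map fun z => z - y) (v - L⁻¹ • y) ∂μ) / μ (rootCell L v)) ∂P :=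
  fun _ _ hδ hL _ hf hper _ hcore hstat => lintegral_phase_eq_cellAverage hδ hL hf hper hcore hstat

end Summit.AtomisticToContinuum.Crystallization.Theorems.SlackRigidityLawCellAverage

end
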